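import Mathlib
import HarnessLib
import Summits.ValiantsHypothesis.ValiantsHypothesis.Theses.MonotoneRestoration
import Literature.Computability.AlgebraicComplexity.ArithCircuit
import Literature.Computability.AlgebraicComplexity.ArithCircuitProofs
import Literature.Computability.AlgebraicComplexity.MonotoneStructure
import Literature.Computability.AlgebraicComplexity.PermanentIrreducible
import Literature.ModelTheory.FiniteModelTheory.CkEquiv
import Summits.ValiantsHypothesis.ValiantsHypothesis.Theorems.MonotoneRestorationMonotoneRestorationQPCosetCount
import Summits.ValiantsHypothesis.ValiantsHypothesis.Theorems.MonotoneRestorationMonotoneRestorationQPSymmetricLB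
import Summits.ValiantsHypothesis.ValiantsHypothesis.Theorems.MonotoneRestorationMonotoneRestorationQPSupportSymmetrisation
import Summits.ValiantsHypothesis.ValiantsHypothesis.Theorems.MonotoneRestorationMonotoneRestorationQPSparseRegime
import Summits.ValiantsHypothesis.ValiantsHypothesis.Theorems.MonotoneRestorationMonotoneRestorationQPBeta
import Literature.Computability.AlgebraicComplexity.SymmetricArithCircuit
import Literature.Computability.AlgebraicComplexity.DawarWilsenach2025Proofs
import Literature.GroupTheory.PermutationGroups.SmallIndexSubgroups
import Summits.ValiantsHypothesis.ValiantsHypothesis.Theorems.MonotoneRestorationQP.Negative.LoadBearing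
import Summits.ValiantsHypothesis.ValiantsHypothesis.Theorems.MonotoneRestorationMonotoneRestorationQPPermSupportCount

/-! TTRL-lite variant V19936 of stmt-ValiantsHypothesis-15886 -/

set_option linter.dupNamespace false

namespace Summit.ValiantsHypothesis.ValiantsHypothesis.Theorems

open Summit.ValiantsHypothesis.ValiantsHypothesis.Theses.MonotoneRestoration
open Literature.Computability.AlgebraicComplexity

/-- Kernel of the `c`-monotonicity lemma: the support size `(L+c)^c + 2` is nondecreasing
in `c` (base monotonicity `Nat.pow_le_pow_left`, then exponent monotonicity
`Nat.pow_le_pow_right` with base `L + (c+1) ≥ 1`). TTRL-lite variant V19936 of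
`stmt-ValiantsHypothesis-15886`. -/
theorem stub_gammaArithmetic_var19936 :
    ∀ (L c : ℕ), (L + c) ^ c + 2 ≤ (L + (c + 1)) ^ (c + 1) + 2 := by
  intro L c
  have h1 : (L + c) ^ c ≤ (L + (c + 1)) ^ c :=
    Nat.pow_le_pow_left (by omega) c
  have h2 : (L + (c + 1)) ^ c ≤ (L + (c + 1)) ^ (c + 1) :=
    Nat.pow_le_pow_right (by omega) (by omega)
  omega

end Summit.ValiantsHypothesis.ValiantsHypothesis.Theorems
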